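import Summits.AtomisticToContinuum.Crystallization.Theorems.ChargedEnergyGapIsoKernel
import HarnessLib

/-!
# Charged energy gap — lens-3 g64, node «BarlowRef» (R3) — part 20 (addendum; imports part 19): the per-source kernel of the NEAR-TUBE sources (half-annuli)

The third per-source kernel of the certificate recipe (HANDOFF g65, item 2), for sources with `r < a := dist y c` but `a` close to `r` (cert64's
«inside regime» `r < a ≤ 2r`, where the shadow cone is too wide to pay for itself): every target seen through the tube lies on the FORWARD side
of the source — `√(a² − r²) · dist y z ≤ a · ⟪b 2, z − y⟫` (part 15) — so distance classes `[β_k, β_{k+1})` are counted as thickened HALF-ANNULI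
above the level `τ_k` (part 16 `card_mul_le_capAnnulus_of_subset_image`), `τ_k ≥ 0` any numbers with `τ_k² a² ≤ (a² − r²) β_k²`:

  ★★ `half_kernel_mul_le` :
  `(Σ_{z ∈ T} [y ≠ z ∧ infDist c [y,z] ≤ r] (dist y z)⁻⁶) · V`
  `  ≤ Σ_{k<K} (capVol (β_{k+1} + 9/5) (τ_k − 9/5) − capVol (β_k − 9/5) (τ_k − 9/5)) · β_k⁻⁶ + (500π/21)/β_K³`

(`18/5 ≤ β₀ ≤ … ≤ β_K`, `T ⊆` image, and `dist y z ≥ β₀` for the targets SEEN THROUGH THE TUBE — part 18's `add_le_dist_of_test` supplies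
`β₀ = q₁ + q₂` beyond the pair separation; isotropic closed-form tail beyond `β_K`, part 19).  With parts 18–20 every
source of the block scheme has a typed kernel bound matching cert64's three regimes.  0 sorry; standard axioms.
-/

noncomputable section

open scoped Classical RealInnerProductSpace
open Literature.MathematicalPhysics.StatisticalMechanics Literature.Geometry.DiscreteGeometry
open Summit.AtomisticToContinuum.Crystallization.Theses.PricedLinkCensus
open Summit.AtomisticToContinuum.Crystallization.Theorems.ChargedEnergyGapNegative

namespace Summit.AtomisticToContinuum.Crystallization.Theorems.ChargedEnergyGapChartDial

section HalfKernel

/-- The level of a class is below its inner radius: `τ² a² ≤ (a² − r²) β²`, `0 ≤ τ`, `0 ≤ β`, `0 < a` ⟹ `τ ≤ β`. [formal bookkeeping] -/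
theorem level_le_radius {a r τ β : ℝ} (ha : 0 < a) (hτ : 0 ≤ τ) (hβ : 0 ≤ β) (h : τ ^ 2 * a ^ 2 ≤ (a ^ 2 - r ^ 2) * β ^ 2) : τ ≤ β := by
  have h1 : τ ^ 2 * a ^ 2 ≤ β ^ 2 * a ^ 2 := by nlinarith [sq_nonneg r, sq_nonneg β]
  have h2 : τ ^ 2 ≤ β ^ 2 := le_of_mul_le_mul_right h1 (by positivity)
  exact (pow_le_pow_iff_left₀ hτ hβ two_ne_zero).1 h2

/-- ★★ The per-source kernel of a NEAR-TUBE source via half-annuli (see the module docstring). -/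
theorem half_kernel_mul_le {a h : ℝ} {s : ℤ → ℤ} {g : E3 → E3}
    (ha : 9 / 10 ≤ a ∧ a ≤ 11 / 10) (hh : 0 < h ∧ 27 / 50 * a ^ 2 ≤ h ^ 2 ∧ h ^ 2 ≤ 121 / 150 * a ^ 2) (hg : Isometry g)
    {y c : E3} {r : ℝ} (hr : 0 ≤ r) (hry : r < dist y c)
    (β τ : ℕ → ℝ) (K : ℕ) (hmono : ∀ k, β k ≤ β (k + 1)) (hβ0 : 18 / 5 ≤ β 0)
    (hτ0 : ∀ k, 0 ≤ τ k) (hτs : ∀ k, τ k ^ 2 * dist y c ^ 2 ≤ (dist y c ^ 2 - r ^ 2) * β k ^ 2)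
    (T : Finset E3) (hT : ↑T ⊆ g '' barlowStacking a h s)
    (hTy : ∀ z ∈ T, y ≠ z → Metric.infDist c (segment ℝ y z) ≤ r → β 0 ≤ dist y z) :
    (∑ z ∈ T, if y ≠ z ∧ Metric.infDist c (segment ℝ y z) ≤ r then (dist y z)⁻¹ ^ 6 else 0) * (a * (a * √3 / 2) * h) ≤
      ∑ k ∈ Finset.range K, (capVol (β (k + 1) + 9 / 5) (τ k - 9 / 5) - capVol (β k - 9 / 5) (τ k - 9 / 5)) * (β k)⁻¹ ^ 6 +
        500 * Real.pi / 21 / β K ^ 3 := by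
  have ha0 : 0 ≤ a := by linarith [ha.1]
  have hV0 : 0 ≤ a * (a * √3 / 2) * h := by have := hh.1.le; positivity
  have hApos : 0 < dist y c := hr.trans_lt hry
  have hyc : y ≠ c := fun h0 => by rw [h0, dist_self] at hApos; exact lt_irrefl _ hApos
  obtain ⟨b, hb⟩ := exists_orthonormalBasis_axis hyc
  have hβpos : ∀ k, 18 / 5 ≤ β k := fun k => hβ0.trans (le_of_succ_le_nat hmono k)
  -- the test-true targets
  set T' := T.filter (fun z => y ≠ z ∧ Metric.infDist c (segment ℝ y z) ≤ r) with hT'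
  have hsumT' : (∑ z ∈ T, if y ≠ z ∧ Metric.infDist c (segment ℝ y z) ≤ r then (dist y z)⁻¹ ^ 6 else 0) =
      ∑ z ∈ T', (dist y z)⁻¹ ^ 6 := by
    rw [hT', Finset.sum_filter]
  have hT'T : T' ⊆ T := Finset.filter_subset _ _
  have hT'sub : (↑T' : Set E3) ⊆ g '' barlowStacking a h s := subset_trans (Finset.coe_subset.2 hT'T) hT
  have hgeo : ∀ z ∈ T', β 0 ≤ dist y z ∧ Real.sqrt (dist y c ^ 2 - r ^ 2) * dist y z ≤ dist y c * ⟪b 2, z - y⟫ := by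
    intro z hz
    rw [hT', Finset.mem_filter] at hz
    obtain ⟨hzT, hne, hinf⟩ := hz
    obtain ⟨p, hp, hpc⟩ := exists_mem_segment_dist_le hinf
    exact ⟨hTy z hzT hne hinf, (radial_sq_le_of_shadow hb hp hpc hry).2⟩
  -- class index by distance
  set cls : E3 → ℕ := fun z => Nat.findGreatest (fun k => β k ≤ dist y z) K with hcls
  have hcls_le : ∀ z, cls z ≤ K := fun z => Nat.findGreatest_le K
  have hcls_spec : ∀ z ∈ T', β (cls z) ≤ dist y z := fun z hz =>
    Nat.findGreatest_spec (P := fun k => β k ≤ dist y z) (Nat.zero_le K) (hgeo z hz).1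
  have hcls_lt : ∀ z ∈ T', cls z < K → dist y z < β (cls z + 1) := fun z _ hlt =>
    lt_of_not_ge (Nat.findGreatest_is_greatest (P := fun k => β k ≤ dist y z) (Nat.lt_succ_self _) hlt)
  have hfib : ∑ z ∈ T', (dist y z)⁻¹ ^ 6 = ∑ k ∈ Finset.range (K + 1), ∑ z ∈ T' with cls z = k, (dist y z)⁻¹ ^ 6 := by
    rw [Finset.sum_fiberwise_of_maps_to]
    intro z _
    exact Finset.mem_range.2 (Nat.lt_succ_of_le (hcls_le z))
  -- per class `k < K`: a thickened half-annulus above the level `τ k`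
  have hclass : ∀ k ∈ Finset.range K, (∑ z ∈ T' with cls z = k, (dist y z)⁻¹ ^ 6) * (a * (a * √3 / 2) * h) ≤
      (capVol (β (k + 1) + 9 / 5) (τ k - 9 / 5) - capVol (β k - 9 / 5) (τ k - 9 / 5)) * (β k)⁻¹ ^ 6 := by
    intro k hk
    have hkK : k < K := Finset.mem_range.1 hk
    have hβk : 0 < β k := by linarith [hβpos k]
    set Tk := T'.filter (fun z => cls z = k) with hTk
    have hmem : ∀ z ∈ Tk, z ∈ T' ∧ β k ≤ dist y z ∧ dist y z < β (k + 1) := by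
      intro z hz
      rw [hTk, Finset.mem_filter] at hz
      obtain ⟨hzT', hzk⟩ := hz
      have hsp := hcls_spec z hzT'
      have hlt := hcls_lt z hzT' (hzk ▸ hkK)
      rw [hzk] at hsp hlt
      exact ⟨hzT', hsp, hlt⟩
    have hw : ∀ z ∈ Tk, (dist y z)⁻¹ ^ 6 ≤ (β k)⁻¹ ^ 6 := fun z hz =>
      pow_le_pow_left₀ (inv_nonneg.2 dist_nonneg) (inv_anti₀ hβk (hmem z hz).2.1) 6
    have h1 : ∑ z ∈ Tk, (dist y z)⁻¹ ^ 6 ≤ Tk.card * (β k)⁻¹ ^ 6 := by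
      rw [← nsmul_eq_mul, ← Finset.sum_const]
      exact Finset.sum_le_sum hw
    have hlev : ∀ z ∈ Tk, τ k ≤ ⟪b 2, z - y⟫ := fun z hz =>
      start_le_axial hr hry (hτ0 k) hβk.le (hmem z hz).2.1 (hτs k) (hgeo z (hmem z hz).1).2
    have hτβ : τ k ≤ β k := level_le_radius hApos (hτ0 k) hβk.le (hτs k)
    have h2 := card_mul_le_capAnnulus_of_subset_image (τ := τ k) (R₁ := β k) (R₂ := β (k + 1)) ha hh hg b y (hmono k)
      (by linarith [hτ0 k, hβpos k]) (by linarith) Tk (subset_trans (Finset.coe_subset.2 (Finset.filter_subset _ _)) hT'sub) hlev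
      (fun z hz => by rw [dist_comm]; exact (hmem z hz).2.1) (fun z hz => by rw [dist_comm]; exact (hmem z hz).2.2.le)
    calc (∑ z ∈ Tk, (dist y z)⁻¹ ^ 6) * (a * (a * √3 / 2) * h)
        ≤ (Tk.card * (β k)⁻¹ ^ 6) * (a * (a * √3 / 2) * h) := mul_le_mul_of_nonneg_right h1 hV0
      _ = (Tk.card * (a * (a * √3 / 2) * h)) * (β k)⁻¹ ^ 6 := by ring
      _ ≤ (capVol (β (k + 1) + 9 / 5) (τ k - 9 / 5) - capVol (β k - 9 / 5) (τ k - 9 / 5)) * (β k)⁻¹ ^ 6 :=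
          mul_le_mul_of_nonneg_right h2 (by positivity)
  -- tail: isotropic beyond `β K`
  have htail : (∑ z ∈ T' with cls z = K, (dist y z)⁻¹ ^ 6) * (a * (a * √3 / 2) * h) ≤ 500 * Real.pi / 21 / β K ^ 3 := by
    refine iso_tail_sum_mul_le (s := s) ha hh hg y (hβpos K) _ ?_ ?_
    · exact subset_trans (Finset.coe_subset.2 (Finset.filter_subset _ _)) hT'sub
    · intro z hz
      obtain ⟨hzT', hzk⟩ := Finset.mem_filter.1 hz
      have hsp := hcls_spec z hzT'
      rw [hzk] at hsp
      exact hsp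
  rw [hsumT', hfib, Finset.sum_range_succ, add_mul, Finset.sum_mul]
  exact add_le_add (Finset.sum_le_sum hclass) htail

end HalfKernel

end Summit.AtomisticToContinuum.Crystallization.Theorems.ChargedEnergyGapChartDial

end
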